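import Mathlib
import Summits.NavierStokesRegularity.NavierStokesRegularity.Theses.LevelSetModeration
import Summits.NavierStokesRegularity.NavierStokesRegularity.Theorems.LevelSetModerationLevelSetEnergyInequality
import Summits.NavierStokesRegularity.NavierStokesRegularity.Theorems.LevelSetModerationHighSpeedPressureWorkPressureFreeViscous
import Summits.NavierStokesRegularity.NavierStokesRegularity.Theorems.TypeICertificateLadderRungReynoldsOneTaoCover
import Literature.Analysis.FluidPDE.NormalisedPressureDischarge

/-!
# Route LevelSetModeration — crux `HighSpeedPressureWork`, line `pressure_free_split`:
# stub S0 `stub_pressureFreeBound` and the exact level-set balance (closing file)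

For a classical solution of the unforced Navier–Stokes system on `ℝ³ × [0, T)` which is
Leray–Hopf from its rapidly decaying datum, a level `c > 0` with `|u₀| ≤ c`, and `t < T`:
`-∫₀ᵗ∫ (1 - c/|u|)₊ u·∇p̃[u] = ½ ∫ (|u(t)| - c)₊² + ν ∫₀ᵗ∫ 1_{|u|>c} [(c/|u|) |∇|u||² + (1 - c/|u|) |∇u|²_F]`
(`levelSetModeration_pressureFreeBalance`; Vasseur 2007, Lemma 11, globalised, as an IDENTITY —
the tree's `LevelSetEnergyInequality` is its lower half, dropping `(1 - c/|u|)(|∇u|²_F - |∇|u||²)`).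
The registered stub `stub_pressureFreeBound` (item stmt-NavierStokesRegularity-18149, S0) is the
upper half. Proof as in `levelSetModeration_levelSetEnergyInequality_proof` (Tao-class cover of
`[0, t]`, `slice_identity`, `truncSq_balance`, `∇q = ∇p̃[u]` a.e. in time) with ONE new input,
the viscous identity `-∫ k₀⟪Δu, u⟫ = ∫ 1_{|u|>c}[(c/|u|)‖D|u|‖² + (1-c/|u|)|Du|²_F]`
(`neg_integral_weight_laplacian_eq`: `viscous_slice_eq` of the companion file plus the pointwise
identities `‖D|u|‖² = Σᵢ⟪u,∂ᵢu⟫²/|u|²`, `|Du|²_F = Σᵢ‖∂ᵢu‖²`).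

## References
* A. F. Vasseur, NoDEA 14 (2007), Lemma 11, (12). [Vasseur2007]
* T. Tao, Anal. PDE 6 (2013), Lemma 4.1 (i), Thm. 5.4, Cor. 11.1. [Tao2011]
-/

noncomputable section

-- single-conjunct summit: `Summit.<Summit>.<Problem>` repeats the name by the D-0017 layout
set_option linter.dupNamespace false

namespace Summit.NavierStokesRegularity.NavierStokesRegularity.Theorems.LevelSetEnergyInequality

open Real Set Filter Topology MeasureTheory InnerProductSpace
open scoped RealInnerProductSpace ENNReal Laplacian
open Literature.Analysis.FluidPDE

/-- For a real functional on `ℝ³`, `Σᵢ L(eᵢ)² = ‖L‖²` (Riesz representation). -/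
theorem sum_sq_apply_basisFun_eq_norm_sq (L : EuclideanSpace ℝ (Fin 3) →L[ℝ] ℝ) :
    ∑ i, L (EuclideanSpace.basisFun (Fin 3) ℝ i) ^ 2 = ‖L‖ ^ 2 := by
  set v := (InnerProductSpace.toDual ℝ (EuclideanSpace ℝ (Fin 3))).symm L with hv
  have hL : ∀ w, L w = ⟪v, w⟫ := fun w => by rw [hv, InnerProductSpace.toDual_symm_apply]
  have hn : ‖L‖ = ‖v‖ := by rw [hv, LinearIsometryEquiv.norm_map]
  rw [hn, EuclideanSpace.real_norm_sq_eq]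
  refine Finset.sum_congr rfl fun i _ => ?_
  rw [hL, EuclideanSpace.basisFun_apply, EuclideanSpace.inner_single_right]
  simp

/-- **`‖D|u|(x)‖² = Σᵢ ⟪u(x), ∂ᵢu(x)⟫² / |u(x)|²`** at points where `u(x) ≠ 0` (for `u`
differentiable at `x`): `D|u|(x) = |u|⁻¹ ⟪u, Du ·⟫`, and the operator norm of a functional on `ℝ³`
is the Euclidean norm of its coordinates. -/
theorem norm_fderiv_norm_sq_eq {u : EuclideanSpace ℝ (Fin 3) → EuclideanSpace ℝ (Fin 3)}
    {x : EuclideanSpace ℝ (Fin 3)} (hu : DifferentiableAt ℝ u x) (hx : u x ≠ 0) :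
    ‖fderiv ℝ (fun y => ‖u y‖) x‖ ^ 2 =
      (∑ i, ⟪u x, fderiv ℝ u x (EuclideanSpace.basisFun (Fin 3) ℝ i)⟫ ^ 2) / ‖u x‖ ^ 2 := by
  have hux : 0 < ‖u x‖ := norm_pos_iff.2 hx
  have hD : HasFDerivAt (fun y => ‖u y‖) ((‖u x‖⁻¹ • innerSL ℝ (u x)).comp (fderiv ℝ u x)) x :=
    (hasFDerivAt_norm_of_ne_zero hx).comp x hu.hasFDerivAt
  rw [hD.fderiv, ← sum_sq_apply_basisFun_eq_norm_sq, Finset.sum_div]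
  refine Finset.sum_congr rfl fun i _ => ?_
  rw [ContinuousLinearMap.comp_apply, FunLike.coe_smul, Pi.smul_apply, innerSL_apply_apply,
    smul_eq_mul]
  field_simp

/-- **The moderated dissipation density, pointwise** (`k₀ = (|u|-c)₊/max(|u|,c)`,
`G = Σᵢ⟪u,∂ᵢu⟫²/max(|u|,c)²`; on the level set `k₀ = 1 - c/|u|`, `G = ‖D|u|‖²`, `Σᵢ‖∂ᵢu‖² = |Du|²_F`):
`k₀ Σᵢ‖∂ᵢu‖² + 1_{|u|>c}(1 - k₀) G = 1_{|u|>c} [(c/|u|) ‖D|u|‖² + (1 - c/|u|) |Du|²_F]`. -/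
theorem moderatedDensity_eq {c : ℝ} (hc : 0 < c)
    {u : EuclideanSpace ℝ (Fin 3) → EuclideanSpace ℝ (Fin 3)} (hu : Differentiable ℝ u)
    (x : EuclideanSpace ℝ (Fin 3)) :
    max (‖u x‖ - c) 0 / max ‖u x‖ c *
          (∑ i, ‖fderiv ℝ u x (EuclideanSpace.basisFun (Fin 3) ℝ i)‖ ^ 2) +
        Set.indicator {x | c < ‖u x‖} (fun x => (1 - max (‖u x‖ - c) 0 / max ‖u x‖ c) *
          ((∑ i, ⟪u x, fderiv ℝ u x (EuclideanSpace.basisFun (Fin 3) ℝ i)⟫ ^ 2) /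
            max ‖u x‖ c ^ 2)) x =
      Set.indicator {x | c < ‖u x‖} (fun x => c / ‖u x‖ * ‖fderiv ℝ (fun y => ‖u y‖) x‖ ^ 2 +
        (1 - c / ‖u x‖) * frobeniusNormSq (fderiv ℝ (u) x)) x := by
  by_cases hx : c < ‖u x‖
  · rw [Set.indicator_of_mem (show x ∈ {x | c < ‖u x‖} from hx),
      Set.indicator_of_mem (show x ∈ {x | c < ‖u x‖} from hx)]
    have hux : u x ≠ 0 := by
      intro h0; rw [h0, norm_zero] at hx; exact absurd hx (not_lt.2 hc.le)
    have hun : 0 < ‖u x‖ := norm_pos_iff.2 hux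
    rw [weight_eq_of_le_norm hc _ hx.le, max_eq_left hx.le, norm_fderiv_norm_sq_eq (hu x) hux,
      frobeniusNormSq_eq_sum (EuclideanSpace.basisFun (Fin 3) ℝ)]
    have : (1 - (1 - c / ‖u x‖)) = c / ‖u x‖ := by ring
    rw [this]
    ring
  · rw [Set.indicator_of_notMem (show x ∉ {x | c < ‖u x‖} from hx),
      Set.indicator_of_notMem (show x ∉ {x | c < ‖u x‖} from hx),
      weight_eq_zero_of_norm_le _ (not_lt.1 hx)]
    ring

/-- **The viscous identity, printed form** (`u ∈ C²`, `u, Du, D²u ∈ L²`, `c > 0`):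
`-∫ k₀(u) ⟪Δu, u⟫ = ∫ 1_{|u|>c} [(c/|u|) ‖D|u|‖² + (1 - c/|u|) |Du|²_F]`. -/
theorem neg_integral_weight_laplacian_eq {c : ℝ} (hc : 0 < c)
    {u : EuclideanSpace ℝ (Fin 3) → EuclideanSpace ℝ (Fin 3)} (hu : ContDiff ℝ 2 u)
    (h0 : ∫⁻ x, ‖u x‖ₑ ^ 2 < ⊤) (h1 : ∫⁻ x, ‖iteratedFDeriv ℝ 1 u x‖ₑ ^ 2 < ⊤)
    (h2 : ∫⁻ x, ‖iteratedFDeriv ℝ 2 u x‖ₑ ^ 2 < ⊤) :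
    -∫ x, max (‖u x‖ - c) 0 / max ‖u x‖ c * ⟪(Δ u) x, u x⟫ =
      ∫ x, Set.indicator {x | c < ‖u x‖} (fun x => c / ‖u x‖ * ‖fderiv ℝ (fun y => ‖u y‖) x‖ ^ 2 +
        (1 - c / ‖u x‖) * frobeniusNormSq (fderiv ℝ (u) x)) x := by
  rw [viscous_slice_eq hc hu h0 h1 h2, neg_neg]
  refine integral_congr_ae (Eventually.of_forall fun x => ?_)
  exact moderatedDensity_eq hc ((hu.of_le one_le_two).differentiable one_ne_zero) x

end Summit.NavierStokesRegularity.NavierStokesRegularity.Theorems.LevelSetEnergyInequality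

namespace Summit.NavierStokesRegularity.NavierStokesRegularity.Theorems

open Real Set Filter Topology MeasureTheory InnerProductSpace Function
open scoped RealInnerProductSpace ENNReal NNReal Laplacian
open Literature.Analysis.FluidPDE
open Summit.NavierStokesRegularity.NavierStokesRegularity.Theorems.LevelSetEnergyInequality

/-- **The exact level-set balance on a Tao-class slab** `[0, t] × ℝ³` (classical solution
`(u, q)`, `t > 0`, slice `L²` Sobolev bounds for `u`, `∂ₜu`, `q`, `u` bounded, `c > 0`, `|u(0)| ≤ c`):
`-∫₀ᵗ∫ k₀(u)⟪∇q, u⟫ = ½∫(|u(t)|-c)₊² + ν ∫₀ᵗ∫ 1_{|u|>c}[(c/|u|)‖D|u|‖² + (1-c/|u|)|Du|²_F]`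
(Vasseur 2007, Lemma 11, as an identity: `truncSq_balance`, `slice_identity`,
`neg_integral_weight_laplacian_eq`; the moderated dissipation converted to `ℝ≥0∞` slice-wise). -/
theorem pressureFreeBalance_slab {ν t c B : ℝ} (ht : 0 < t) (hc : 0 < c)
    {u : ℝ → EuclideanSpace ℝ (Fin 3) → EuclideanSpace ℝ (Fin 3)}
    {q : ℝ → EuclideanSpace ℝ (Fin 3) → ℝ}
    (hcl : IsClassicalNSSolutionOn (Icc 0 t) ν 0 u q) (hB : ∀ τ ∈ Icc 0 t, ∀ x, ‖u τ x‖ ≤ B)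
    {C₀ C₁ C₂ Ct Cq : ℝ≥0} (hC₀ : ∀ τ ∈ Icc 0 t, ∫⁻ x, ‖u τ x‖ₑ ^ 2 ≤ C₀)
    (hC₁ : ∀ τ ∈ Icc 0 t, ∫⁻ x, ‖iteratedFDeriv ℝ 1 (u τ) x‖ₑ ^ 2 ≤ C₁)
    (hC₂ : ∀ τ ∈ Icc 0 t, ∫⁻ x, ‖iteratedFDeriv ℝ 2 (u τ) x‖ₑ ^ 2 ≤ C₂)
    (hCt : ∀ τ ∈ Icc 0 t, ∫⁻ x, ‖timeDerivWithin (Icc 0 t) u τ x‖ₑ ^ 2 ≤ Ct)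
    (hCq : ∀ τ ∈ Icc 0 t, ∫⁻ x, ‖iteratedFDeriv ℝ 1 (q τ) x‖ₑ ^ 2 ≤ Cq)
    (hc0 : ∀ x, ‖u 0 x‖ ≤ c) :
    -(∫ τ in Ioo 0 t, ∫ x, max (‖u τ x‖ - c) 0 / max ‖u τ x‖ c * ⟪gradient (q τ) x, u τ x⟫) =
      1 / 2 * (∫ x, (max (‖u t x‖ - c) 0) ^ 2) +
        ν * (∫⁻ τ in Ioo 0 t, ∫⁻ x, Set.indicator {x | c < ‖u τ x‖}
          (fun x => ENNReal.ofReal (c / ‖u τ x‖ * ‖fderiv ℝ (fun y => ‖u τ y‖) x‖ ^ 2 +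
            (1 - c / ‖u τ x‖) * frobeniusNormSq (fderiv ℝ (u τ) x))) x).toReal := by
  have hU : UniqueDiffOn ℝ (Icc 0 t) := uniqueDiffOn_Icc ht
  -- slice regularity and `L²` finiteness
  have hu2 : ∀ τ ∈ Icc 0 t, ContDiff ℝ 2 (u τ) := fun τ hτ =>
    (hcl.contDiff_velocity hτ).of_le (by norm_cast)
  have hq1 : ∀ τ ∈ Icc 0 t, ContDiff ℝ 1 (q τ) := fun τ hτ =>
    (hcl.contDiff_pressure hτ).of_le (by norm_cast)
  have f0 : ∀ τ ∈ Icc 0 t, ∫⁻ x, ‖u τ x‖ₑ ^ 2 < ⊤ := fun τ hτ => (hC₀ τ hτ).trans_lt ENNReal.coe_lt_top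
  have f1 : ∀ τ ∈ Icc 0 t, ∫⁻ x, ‖iteratedFDeriv ℝ 1 (u τ) x‖ₑ ^ 2 < ⊤ := fun τ hτ =>
    (hC₁ τ hτ).trans_lt ENNReal.coe_lt_top
  have f2 : ∀ τ ∈ Icc 0 t, ∫⁻ x, ‖iteratedFDeriv ℝ 2 (u τ) x‖ₑ ^ 2 < ⊤ := fun τ hτ =>
    (hC₂ τ hτ).trans_lt ENNReal.coe_lt_top
  have fq : ∀ τ ∈ Icc 0 t, ∫⁻ x, ‖iteratedFDeriv ℝ 1 (q τ) x‖ₑ ^ 2 < ⊤ := fun τ hτ =>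
    (hCq τ hτ).trans_lt ENNReal.coe_lt_top
  -- the slice identity `∫ k₀⟪W, u⟫ = ν ∫ k₀⟪Δu, u⟫ - ∫ k₀⟪∇q, u⟫`
  have hslice : ∀ τ ∈ Icc 0 t,
      ∫ x, max (‖u τ x‖ - c) 0 / max ‖u τ x‖ c * ⟪timeDerivWithin (Icc 0 t) u τ x, u τ x⟫ =
        ν * (∫ x, max (‖u τ x‖ - c) 0 / max ‖u τ x‖ c * ⟪(Δ (u τ)) x, u τ x⟫) -
          ∫ x, max (‖u τ x‖ - c) 0 / max ‖u τ x‖ c * ⟪gradient (q τ) x, u τ x⟫ := by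
    intro τ hτ
    have hmom : ∀ x, timeDerivWithin (Icc 0 t) u τ x + fderiv ℝ (u τ) x (u τ x) =
        ν • (Δ (u τ)) x - gradient (q τ) x := by
      intro x
      have := hcl.momentum τ hτ x
      simp only [convect_apply, Pi.zero_apply, add_zero] at this
      exact this
    exact slice_identity hc (hu2 τ hτ) (hq1 τ hτ) hmom (hcl.divFree τ hτ) (hB τ hτ) (f0 τ hτ)
      (f1 τ hτ) (f2 τ hτ) (fq τ hτ)
  -- the viscous identity, slice by slice
  have hvisc : ∀ τ ∈ Icc 0 t,
      -∫ x, max (‖u τ x‖ - c) 0 / max ‖u τ x‖ c * ⟪(Δ (u τ)) x, u τ x⟫ =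
        ∫ x, Set.indicator {x | c < ‖u τ x‖}
          (fun x => c / ‖u τ x‖ * ‖fderiv ℝ (fun y => ‖u τ y‖) x‖ ^ 2 +
            (1 - c / ‖u τ x‖) * frobeniusNormSq (fderiv ℝ (u τ) x)) x :=
    fun τ hτ => neg_integral_weight_laplacian_eq hc (hu2 τ hτ) (f0 τ hτ) (f1 τ hτ) (f2 τ hτ)
  -- the moderated density is nonnegative and integrable on each slice
  have hdens0 : ∀ τ ∈ Icc 0 t, ∀ x, 0 ≤ Set.indicator {x | c < ‖u τ x‖}
      (fun x => c / ‖u τ x‖ * ‖fderiv ℝ (fun y => ‖u τ y‖) x‖ ^ 2 +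
        (1 - c / ‖u τ x‖) * frobeniusNormSq (fderiv ℝ (u τ) x)) x := by
    intro τ _ x
    refine Set.indicator_nonneg (fun y hy => ?_) x
    have hy' : c < ‖u τ y‖ := hy
    have hpos : 0 < ‖u τ y‖ := hc.trans hy'
    have h1 : 0 ≤ c / ‖u τ y‖ := div_nonneg hc.le hpos.le
    have h2 : 0 ≤ 1 - c / ‖u τ y‖ := by
      rw [sub_nonneg, div_le_one hpos]; exact hy'.le
    exact add_nonneg (mul_nonneg h1 (sq_nonneg _)) (mul_nonneg h2 (frobeniusNormSq_nonneg _))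
  have hdensI : ∀ τ ∈ Icc 0 t, Integrable (fun x => Set.indicator {x | c < ‖u τ x‖}
      (fun x => c / ‖u τ x‖ * ‖fderiv ℝ (fun y => ‖u τ y‖) x‖ ^ 2 +
        (1 - c / ‖u τ x‖) * frobeniusNormSq (fderiv ℝ (u τ) x)) x) volume := by
    intro τ hτ
    set e := EuclideanSpace.basisFun (Fin 3) ℝ with he
    have hud : Differentiable ℝ (u τ) := ((hu2 τ hτ).of_le one_le_two).differentiable one_ne_zero
    have hfun : (fun x => Set.indicator {x | c < ‖u τ x‖}
        (fun x => c / ‖u τ x‖ * ‖fderiv ℝ (fun y => ‖u τ y‖) x‖ ^ 2 +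
          (1 - c / ‖u τ x‖) * frobeniusNormSq (fderiv ℝ (u τ) x)) x) =
        fun x => max (‖u τ x‖ - c) 0 / max ‖u τ x‖ c *
            (∑ i, ‖fderiv ℝ (u τ) x (e i)‖ ^ 2) +
          Set.indicator {x | c < ‖u τ x‖} (fun x => (1 - max (‖u τ x‖ - c) 0 / max ‖u τ x‖ c) *
            ((∑ i, ⟪u τ x, fderiv ℝ (u τ) x (e i)⟫ ^ 2) / max ‖u τ x‖ c ^ 2)) x :=
      funext fun x => (moderatedDensity_eq hc hud x).symm
    rw [hfun]
    have cu : Continuous (u τ) := (hu2 τ hτ).continuous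
    have cDu : Continuous (fderiv ℝ (u τ)) := (hu2 τ hτ).continuous_fderiv (by norm_num)
    have cdi : ∀ i, Continuous fun x => fderiv ℝ (u τ) x (e i) := fun i =>
      cDu.clm_apply continuous_const
    have ck : Continuous fun x => max (‖u τ x‖ - c) 0 / max ‖u τ x‖ c :=
      (continuous_weight hc).comp cu
    have hk01 : ∀ x, 0 ≤ max (‖u τ x‖ - c) 0 / max ‖u τ x‖ c ∧
        max (‖u τ x‖ - c) 0 / max ‖u τ x‖ c ≤ 1 := fun x => ⟨weight_nonneg hc _, weight_le_one hc _⟩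
    have l2di : ∀ i, ∫⁻ x, ‖fderiv ℝ (u τ) x (e i)‖ₑ ^ 2 < ⊤ := fun i =>
      lintegral_enorm_sq_lt_top_of_norm_le (fun x => norm_fderiv_apply_basisFun_le (u τ) x i) (f1 τ hτ)
    have cF : Continuous fun x => ∑ i, ‖fderiv ℝ (u τ) x (e i)‖ ^ 2 := by fun_prop
    have hF0 : ∀ x, 0 ≤ ∑ i, ‖fderiv ℝ (u τ) x (e i)‖ ^ 2 := fun x =>
      Finset.sum_nonneg fun i _ => sq_nonneg _
    have iF : Integrable (fun x => ∑ i, ‖fderiv ℝ (u τ) x (e i)‖ ^ 2) volume :=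
      integrable_finsetSum _ fun i _ => integrable_sq_norm_of_lintegral_lt_top (cdi i) (l2di i)
    obtain ⟨cG, hG0, iG⟩ := integrable_levelGradSq hc ((hu2 τ hτ).of_le one_le_two) (f1 τ hτ)
    have hS : MeasurableSet {x | c < ‖u τ x‖} :=
      (isOpen_lt continuous_const (continuous_norm.comp cu)).measurableSet
    have i1 : Integrable (fun x => max (‖u τ x‖ - c) 0 / max ‖u τ x‖ c *
        (∑ i, ‖fderiv ℝ (u τ) x (e i)‖ ^ 2)) volume := by
      refine iF.mono' (ck.mul cF).aestronglyMeasurable (Eventually.of_forall fun x => ?_)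
      show ‖max (‖u τ x‖ - c) 0 / max ‖u τ x‖ c * (∑ i, ‖fderiv ℝ (u τ) x (e i)‖ ^ 2)‖ ≤
        ∑ i, ‖fderiv ℝ (u τ) x (e i)‖ ^ 2
      rw [Real.norm_eq_abs, abs_mul, abs_of_nonneg (hk01 x).1, abs_of_nonneg (hF0 x)]
      exact mul_le_of_le_one_left (hF0 x) (hk01 x).2
    have i2 : Integrable (fun x => (1 - max (‖u τ x‖ - c) 0 / max ‖u τ x‖ c) *
        ((∑ i, ⟪u τ x, fderiv ℝ (u τ) x (e i)⟫ ^ 2) / max ‖u τ x‖ c ^ 2)) volume := by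
      refine iG.mono' ((continuous_const.sub ck).mul cG).aestronglyMeasurable
        (Eventually.of_forall fun x => ?_)
      show ‖(1 - max (‖u τ x‖ - c) 0 / max ‖u τ x‖ c) *
          ((∑ i, ⟪u τ x, fderiv ℝ (u τ) x (e i)⟫ ^ 2) / max ‖u τ x‖ c ^ 2)‖ ≤
        (∑ i, ⟪u τ x, fderiv ℝ (u τ) x (e i)⟫ ^ 2) / max ‖u τ x‖ c ^ 2
      rw [Real.norm_eq_abs, abs_mul, abs_of_nonneg (by linarith [(hk01 x).2]),
        abs_of_nonneg (hG0 x)]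
      exact mul_le_of_le_one_left (hG0 x) (by linarith [(hk01 x).1])
    exact i1.add (i2.indicator hS)
  -- time integrability of the viscous and pressure pairings (slab bounds)
  have cu : ContinuousOn (uncurry u) (Icc 0 t ×ˢ univ) := hcl.smooth_velocity.continuousOn
  have cΔ : ContinuousOn (uncurry fun τ x => (Δ (u τ)) x) (Icc 0 t ×ˢ univ) :=
    (hcl.smooth_velocity.laplacian hU).continuousOn
  have cgq : ContinuousOn (uncurry fun τ x => gradient (q τ) x) (Icc 0 t ×ˢ univ) :=
    (hcl.smooth_pressure.gradient hU).continuousOn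
  have ck : Continuous fun v : EuclideanSpace ℝ (Fin 3) => max (‖v‖ - c) 0 / max ‖v‖ c :=
    continuous_weight hc
  have hkabs : ∀ v : EuclideanSpace ℝ (Fin 3), |max (‖v‖ - c) 0 / max ‖v‖ c| ≤ 1 := fun v => by
    rw [abs_of_nonneg (weight_nonneg hc v)]; exact weight_le_one hc v
  have hCΔ : ∀ τ ∈ Icc 0 t, ∫⁻ x, ‖(Δ (u τ)) x‖ₑ ^ 2 ≤ ((3 : ℝ≥0) ^ 2 * C₂ : ℝ≥0) := fun τ hτ => by
    have h := lintegral_enorm_sq_le_of_norm_le_mul (μ := volume) (3 : ℝ≥0)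
      (fun x => norm_laplacian_le_three_mul_norm_iteratedFDeriv_two (hu2 τ hτ) x)
    refine h.trans ?_
    push_cast
    gcongr
    exact hC₂ τ hτ
  have hCgq : ∀ τ ∈ Icc 0 t, ∫⁻ x, ‖gradient (q τ) x‖ₑ ^ 2 ≤ Cq := fun τ hτ =>
    le_of_eq_of_le (lintegral_congr fun x => by
      rw [← ofReal_norm, norm_gradient_eq_norm_iteratedFDeriv_one, ofReal_norm]) (hCq τ hτ)
  have iA : IntegrableOn (fun τ => ∫ x, max (‖u τ x‖ - c) 0 / max ‖u τ x‖ c *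
      ⟪(Δ (u τ)) x, u τ x⟫) (Ioo 0 t) volume := by
    have h := integrable_slab_of_pairing_bound (T := t)
      (g := fun z => max (‖u z.1 z.2‖ - c) 0 / max ‖u z.1 z.2‖ c * ⟪(Δ (u z.1)) z.2, u z.1 z.2⟫)
      (a := fun τ x => (Δ (u τ)) x) (b := u) ((ck.comp_continuousOn cu).mul (cΔ.inner cu))
      (fun τ _ x => by
        rw [abs_mul]
        exact (mul_le_of_le_one_left (abs_nonneg _) (hkabs _)).trans (abs_real_inner_le_norm _ _))
      (fun τ hτ => continuous_laplacian (hu2 τ hτ)) hCΔ hC₀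
    exact h.integral_prod_left
  have iP : IntegrableOn (fun τ => ∫ x, max (‖u τ x‖ - c) 0 / max ‖u τ x‖ c *
      ⟪gradient (q τ) x, u τ x⟫) (Ioo 0 t) volume := by
    have h := integrable_slab_of_pairing_bound (T := t)
      (g := fun z => max (‖u z.1 z.2‖ - c) 0 / max ‖u z.1 z.2‖ c * ⟪gradient (q z.1) z.2, u z.1 z.2⟫)
      (a := fun τ x => gradient (q τ) x) (b := u) ((ck.comp_continuousOn cu).mul (cgq.inner cu))
      (fun τ _ x => by
        rw [abs_mul]
        exact (mul_le_of_le_one_left (abs_nonneg _) (hkabs _)).trans (abs_real_inner_le_norm _ _))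
      (fun τ hτ => continuous_gradient_of_contDiff (hq1 τ hτ)) hCgq hC₀
    exact h.integral_prod_left
  -- the time balance
  obtain ⟨-, hbal⟩ := truncSq_balance hc ht hcl.smooth_velocity hC₀ hCt
  have hinit : ∫ x, (max (‖u 0 x‖ - c) 0) ^ 2 = 0 :=
    integral_eq_zero_of_ae (Eventually.of_forall fun x => truncSq_eq_zero_of_norm_le _ (hc0 x))
  have hPt : ∫ τ in Ioo 0 t, ∫ x, max (‖u τ x‖ - c) 0 / max ‖u τ x‖ c *
      ⟪timeDerivWithin (Icc 0 t) u τ x, u τ x⟫ =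
      ν * (∫ τ in Ioo 0 t, ∫ x, max (‖u τ x‖ - c) 0 / max ‖u τ x‖ c * ⟪(Δ (u τ)) x, u τ x⟫) -
        ∫ τ in Ioo 0 t, ∫ x, max (‖u τ x‖ - c) 0 / max ‖u τ x‖ c * ⟪gradient (q τ) x, u τ x⟫ := by
    rw [setIntegral_congr_fun measurableSet_Ioo fun τ hτ => hslice τ (Ioo_subset_Icc_self hτ),
      integral_sub (iA.const_mul ν) iP, integral_const_mul]
  -- the moderated dissipation as a real integral
  have hnn : 0 ≤ᵐ[volume.restrict (Ioo 0 t)] fun τ =>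
      -∫ x, max (‖u τ x‖ - c) 0 / max ‖u τ x‖ c * ⟪(Δ (u τ)) x, u τ x⟫ := by
    refine (ae_restrict_iff' measurableSet_Ioo).2 (Eventually.of_forall fun τ hτ => ?_)
    show (0 : ℝ) ≤ -∫ x, max (‖u τ x‖ - c) 0 / max ‖u τ x‖ c * ⟪(Δ (u τ)) x, u τ x⟫
    rw [hvisc τ (Ioo_subset_Icc_self hτ)]
    exact integral_nonneg (hdens0 τ (Ioo_subset_Icc_self hτ))
  have hD : (∫⁻ τ in Ioo 0 t, ∫⁻ x, Set.indicator {x | c < ‖u τ x‖}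
      (fun x => ENNReal.ofReal (c / ‖u τ x‖ * ‖fderiv ℝ (fun y => ‖u τ y‖) x‖ ^ 2 +
        (1 - c / ‖u τ x‖) * frobeniusNormSq (fderiv ℝ (u τ) x))) x) =
      ENNReal.ofReal (∫ τ in Ioo 0 t,
        -∫ x, max (‖u τ x‖ - c) 0 / max ‖u τ x‖ c * ⟪(Δ (u τ)) x, u τ x⟫) := by
    have iAn : Integrable (fun τ => -∫ x, max (‖u τ x‖ - c) 0 / max ‖u τ x‖ c *
        ⟪(Δ (u τ)) x, u τ x⟫) (volume.restrict (Ioo 0 t)) := iA.neg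
    rw [ofReal_integral_eq_lintegral_ofReal iAn hnn]
    refine setLIntegral_congr_fun measurableSet_Ioo fun τ hτ => ?_
    have hτ' := Ioo_subset_Icc_self hτ
    rw [hvisc τ hτ', ofReal_integral_eq_lintegral_ofReal (hdensI τ hτ')
      (Eventually.of_forall (hdens0 τ hτ'))]
    refine lintegral_congr fun x => ?_
    by_cases hx : c < ‖u τ x‖
    · rw [Set.indicator_of_mem (show x ∈ {x | c < ‖u τ x‖} from hx),
        Set.indicator_of_mem (show x ∈ {x | c < ‖u τ x‖} from hx)]
    · rw [Set.indicator_of_notMem (show x ∉ {x | c < ‖u τ x‖} from hx),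
        Set.indicator_of_notMem (show x ∉ {x | c < ‖u τ x‖} from hx), ENNReal.ofReal_zero]
  have hDreal : (∫⁻ τ in Ioo 0 t, ∫⁻ x, Set.indicator {x | c < ‖u τ x‖}
      (fun x => ENNReal.ofReal (c / ‖u τ x‖ * ‖fderiv ℝ (fun y => ‖u τ y‖) x‖ ^ 2 +
        (1 - c / ‖u τ x‖) * frobeniusNormSq (fderiv ℝ (u τ) x))) x).toReal =
      -∫ τ in Ioo 0 t, ∫ x, max (‖u τ x‖ - c) 0 / max ‖u τ x‖ c * ⟪(Δ (u τ)) x, u τ x⟫ := by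
    rw [hD, ENNReal.toReal_ofReal (integral_nonneg_of_ae hnn), integral_neg]
  -- assemble
  rw [hinit, zero_add, hPt] at hbal
  rw [hDreal]
  linarith

/-- **The exact level-set balance** for the speed of a classical Leray–Hopf solution from a
rapidly decaying datum, with Tao's normalised pressure (`c > 0`, `|u₀| ≤ c`, `t < T`):
`-∫₀ᵗ∫ (1-c/|u|)₊ Dp̃[u](u) = ½∫(|u(t)|-c)₊² + ν ∫₀ᵗ∫ 1_{|u|>c}[(c/|u|)‖D|u|‖² + (1-c/|u|)|Du|²_F]`
(Vasseur 2007, Lemma 11, as an identity: `pressureFreeBalance_slab` + `∇q = ∇p̃[u]` a.e., Tao). -/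
theorem levelSetModeration_pressureFreeBalance :
    ∀ (ν T : ℝ) (u : ℝ → EuclideanSpace ℝ (Fin 3) → EuclideanSpace ℝ (Fin 3))
      (p : ℝ → EuclideanSpace ℝ (Fin 3) → ℝ), 0 < ν → 0 < T →
      Literature.Analysis.FluidPDE.IsClassicalNSSolutionOn (Set.Ico 0 T) ν 0 u p →
      Literature.Analysis.FluidPDE.IsLerayHopfOn T ν 0 (u 0) u →
      Literature.Analysis.FluidPDE.HasRapidSpatialDecay (u 0) →
      ∀ (c : ℝ), 0 < c → (∀ x, ‖u 0 x‖ ≤ c) → ∀ t ∈ Set.Ico 0 T,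
        -(∫ τ in Set.Ioo 0 t, ∫ x, max (1 - c / ‖u τ x‖) 0 *
            (fderiv ℝ (Literature.Analysis.FluidPDE.normalisedPressure (u τ)) x (u τ x))) =
          1 / 2 * (∫ x, (max (‖u t x‖ - c) 0) ^ 2) +
            ν * (∫⁻ τ in Set.Ioo 0 t, ∫⁻ x, Set.indicator {x | c < ‖u τ x‖}
              (fun x => ENNReal.ofReal (c / ‖u τ x‖ * ‖fderiv ℝ (fun y => ‖u τ y‖) x‖ ^ 2 +
                (1 - c / ‖u τ x‖) *
                  Literature.Analysis.FluidPDE.frobeniusNormSq (fderiv ℝ (u τ) x))) x).toReal := by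
  intro ν T u p hν hT hcl hLH hdec c hc hc0 t ht
  rcases ht.1.eq_or_lt with h0t | htpos
  · -- `t = 0`: every term vanishes
    rw [← h0t]
    have hinit : ∫ x, (max (‖u 0 x‖ - c) 0) ^ 2 = 0 :=
      integral_eq_zero_of_ae (Eventually.of_forall fun x => truncSq_eq_zero_of_norm_le _ (hc0 x))
    simp only [Set.Ioo_self, Measure.restrict_empty, lintegral_zero_measure, integral_zero_measure,
      ENNReal.toReal_zero, mul_zero, add_zero, neg_zero, hinit]
  · -- `0 < t`: Tao-class cover of the closed slab `[0, t]`
    obtain ⟨q, hclq, hBu, hBut, hBq⟩ :=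
      RungReynoldsOne.stub_taoCover hν hT hcl hLH hdec ⟨htpos, ht.2⟩
    obtain ⟨B, -, hB⟩ := exists_forall_norm_le_of_hasBoundedSobolevNormsOn hclq hBu
    obtain ⟨C₀', hC₀'⟩ := hBu 0
    obtain ⟨C₁, hC₁⟩ := hBu 1
    obtain ⟨C₂, hC₂⟩ := hBu 2
    obtain ⟨Ct', hCt'⟩ := hBut 0
    obtain ⟨Cq, hCq⟩ := hBq 1
    have hC₀ : ∀ τ ∈ Icc 0 t, ∫⁻ x, ‖u τ x‖ₑ ^ 2 ≤ C₀' := fun τ hτ =>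
      le_of_eq_of_le (lintegral_congr fun x => by
        rw [← ofReal_norm, ← ofReal_norm (iteratedFDeriv ℝ 0 (u τ) x), norm_iteratedFDeriv_zero])
        (hC₀' τ hτ)
    have hCt : ∀ τ ∈ Icc 0 t, ∫⁻ x, ‖timeDerivWithin (Icc 0 t) u τ x‖ₑ ^ 2 ≤ Ct' := fun τ hτ =>
      le_of_eq_of_le (lintegral_congr fun x => by
        rw [← ofReal_norm, ← ofReal_norm (iteratedFDeriv ℝ 0 (timeDerivWithin (Icc 0 t) u τ) x),
          norm_iteratedFDeriv_zero]) (hCt' τ hτ)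
    have hslab := pressureFreeBalance_slab (ν := ν) htpos hc hclq hB hC₀ hC₁ hC₂ hCt hCq hc0
    -- the pressure work in printed form: `∇q = ∇p̃[u]` for a.e. `τ` (Tao, Lemma 4.1 (i))
    have hE : ∃ C : ℝ≥0∞, C < ⊤ ∧ ∀ τ ∈ Icc 0 t, ∫⁻ x, ‖u τ x‖ₑ ^ 2 ≤ C :=
      ⟨C₀', ENNReal.coe_lt_top, hC₀⟩
    obtain ⟨Cf, -, -, hae⟩ := tao_pressure_normalisation_holds ν t hν htpos u q hclq hE
    have hae' : ∀ᵐ τ ∂(volume.restrict (Ioo 0 t)),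
        ∫ x, max (‖u τ x‖ - c) 0 / max ‖u τ x‖ c * ⟪gradient (q τ) x, u τ x⟫ =
          ∫ x, max (1 - c / ‖u τ x‖) 0 * (fderiv ℝ (normalisedPressure (u τ)) x (u τ x)) := by
      filter_upwards [ae_restrict_of_ae_restrict_of_subset Ioo_subset_Icc_self hae] with τ hτ
      exact integral_weight_pressure_eq hc hτ
    rw [← integral_congr_ae hae']
    exact hslab

/-- **`stub_pressureFreeBound`** (registered stub S0 of line `pressure_free_split`, crux
`HighSpeedPressureWork`, item stmt-NavierStokesRegularity-18149): the upper half of the exact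
level-set balance `levelSetModeration_pressureFreeBalance`. -/
theorem stub_pressureFreeBound :
    ∀ (ν T : ℝ) (u : ℝ → EuclideanSpace ℝ (Fin 3) → EuclideanSpace ℝ (Fin 3))
      (p : ℝ → EuclideanSpace ℝ (Fin 3) → ℝ), 0 < ν → 0 < T →
      Literature.Analysis.FluidPDE.IsClassicalNSSolutionOn (Set.Ico 0 T) ν 0 u p →
      Literature.Analysis.FluidPDE.IsLerayHopfOn T ν 0 (u 0) u →
      Literature.Analysis.FluidPDE.HasRapidSpatialDecay (u 0) →
      ∀ (c : ℝ), 0 < c → (∀ x, ‖u 0 x‖ ≤ c) → ∀ t ∈ Set.Ico 0 T,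
        -(∫ τ in Set.Ioo 0 t, ∫ x, max (1 - c / ‖u τ x‖) 0 *
            (fderiv ℝ (Literature.Analysis.FluidPDE.normalisedPressure (u τ)) x (u τ x))) ≤
          1 / 2 * (∫ x, (max (‖u t x‖ - c) 0) ^ 2) +
            ν * (∫⁻ τ in Set.Ioo 0 t, ∫⁻ x, Set.indicator {x | c < ‖u τ x‖}
              (fun x => ENNReal.ofReal (c / ‖u τ x‖ * ‖fderiv ℝ (fun y => ‖u τ y‖) x‖ ^ 2 +
                (1 - c / ‖u τ x‖) *
                  Literature.Analysis.FluidPDE.frobeniusNormSq (fderiv ℝ (u τ) x))) x).toReal :=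
  fun ν T u p hν hT hcl hLH hdec c hc hc0 t ht =>
    (levelSetModeration_pressureFreeBalance ν T u p hν hT hcl hLH hdec c hc hc0 t ht).le

end Summit.NavierStokesRegularity.NavierStokesRegularity.Theorems

end
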